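import Literature.Probability.RandomPlanarGeometry.USTPeanoPeelAlong
import Literature.Probability.LatticeModels.StoppedWalkSums
import HarnessLib

/-!
# The branch of the tree along a prefix ([LSW04] Lemma 4.1 and proof of Thm. 4.4)

G. F. Lawler, O. Schramm, W. Werner, Ann. Probab. **32** (2004), proof of Theorem 4.4, p. 976:
"By Lemma 4.1, `P[A | D_n]` is the same as the quantity `ĥ_n(v₀)`", `A` being the event that
"the path in the tree `T(γ)` from `v₀` to `α`" hits an arc, and `ĥ_n(v₀)` the probability for
simple random walk in `D_n` stopped on `α_n`.

The combinatorial content: for a Peano path `γ` with the prefix `a, q₁, …, q_n`, the path in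
`T(γ)` from a vertex `v` to `α` is the path in the tree `T'(γ[n, ℓ+1])` of the remainder from
`v` to `α_n` (the roots of the peeled data), followed by a continuation inside `α_n` which is
determined by the prefix (`Good.br_pathForestEquiv_prefix`).  With
`Good.card_prefix_and_eq` (conditional uniformity of the remainder, `USTPeanoPeelAlong.lean`) and
`Good.card_isPath_br_pred_eq` (Wilson's algorithm for the peeled data, `USTPeanoTreeLaw.lean`)
this expresses `P[A | γ[0, n]]` through simple random walk on `H(D_n)` stopped on `α_n`.

Generic ingredients (`Forest` namespace): the branch is the unique parent-chain from `v` stopped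
at the roots (`Forest.br_eq_of_isChain_of_isStoppedAt`), hence the branch towards a smaller root
set is the branch towards a larger one followed by the branch of its endpoint
(`Forest.br_eq_br_append`).
-/

namespace Literature.Probability.LatticeModels

open Literature.Probability.RandomPlanarGeometry RootedForest LoopErasedWalkIdentity StoppedWalk

namespace Forest

variable {V : Type*} [DecidableEq V]

/-- A parent-chain stopped at `R` is the trail of its initial vertex (enough fuel). [folklore] -/
theorem trail_eq_of_isChain_of_isStoppedAt (p : V → V) (R : Finset V) :
    ∀ (L : List V) (v : V) (n : ℕ), L.length ≤ n → List.IsChain (fun a b => p a = b) (v :: L) →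
      IsStoppedAt (↑R : Set V) (v :: L) → v ∉ R → trail p R n v = L
  | [], v, _, _, _, hs, hv => (hv (by simpa using hs.getLast_mem)).elim
  | x :: L, v, 0, hn, _, _, _ => by simp at hn
  | x :: L, v, n + 1, hn, hc, hs, hv => by
    obtain ⟨hpx, hc'⟩ := List.isChain_cons_cons.1 hc
    rw [trail_succ, hpx]
    by_cases hL : L = []
    · subst hL
      have hx : x ∈ R := by simpa using hs.getLast_mem
      rw [if_pos hx]
    · have hs' : IsStoppedAt (↑R : Set V) (x :: L) := hs.tail (List.cons_ne_nil _ _)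
      have hx : x ∉ R := hs'.head_not_mem hL
      rw [if_neg hx, trail_eq_of_isChain_of_isStoppedAt p R L x n
        (by simpa using hn) hc' hs' hx]

omit [DecidableEq V] in
/-- Ranks decrease along a parent-chain whose non-final vertices lie off `R`. [folklore] -/
theorem isChain_rank_of_isChain_parent {p : V → V} {R : Finset V} {r : V → ℕ}
    (hr : ∀ a, a ∉ R → r (p a) < r a) :
    ∀ (l : List V), List.IsChain (fun a b => p a = b) l → (∀ a ∈ l.dropLast, a ∉ R) →
      List.IsChain (fun a b => r b < r a) l
  | [], _, _ => List.IsChain.nil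
  | [_], _, _ => List.isChain_singleton _
  | a :: b :: t, hc, hd => by
    obtain ⟨hab, hc'⟩ := List.isChain_cons_cons.1 hc
    have ha : a ∉ R := hd a (by simp)
    refine List.isChain_cons_cons.2 ⟨hab ▸ hr a ha, isChain_rank_of_isChain_parent hr (b :: t) hc' ?_⟩
    intro x hx
    exact hd x (by rw [List.dropLast_cons_cons]; exact List.mem_cons_of_mem _ hx)

variable [Fintype V] {H H' : SimpleGraph V} {R R' : Finset V}

/-- **The branch is the unique parent-chain from `v` stopped at the roots.** [folklore] -/
theorem br_eq_of_isChain_of_isStoppedAt (F : Forest H R) {v : V} {L : List V}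
    (hc : List.IsChain (fun a b => F.parent a = b) (v :: L))
    (hs : IsStoppedAt (↑R : Set V) (v :: L)) (hv : v ∉ R) : F.br v = L := by
  obtain ⟨r, hr⟩ := F.exists_rank
  have hrank := isChain_rank_of_isChain_parent hr (v :: L) hc
    fun a ha ↦ hs.not_mem_of_mem_dropLast ha
  have hlen := (nodup_of_isChain_rank hrank).length_le_card
  rw [List.length_cons] at hlen
  exact trail_eq_of_isChain_of_isStoppedAt F.parent R L v (Fintype.card V) (by omega) hc hs hv

omit [DecidableEq V] [Fintype V] in
/-- A parent-chain for one map is a parent-chain for another agreeing with it on the non-final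
vertices. [folklore] -/
theorem isChain_parent_congr {p p' : V → V} :
    ∀ (l : List V), List.IsChain (fun a b => p a = b) l → (∀ a ∈ l.dropLast, p' a = p a) →
      List.IsChain (fun a b => p' a = b) l
  | [], _, _ => List.IsChain.nil
  | [_], _, _ => List.isChain_singleton _
  | a :: b :: t, hc, hd => by
    obtain ⟨hab, hc'⟩ := List.isChain_cons_cons.1 hc
    refine List.isChain_cons_cons.2 ⟨(hd a (by simp)).trans hab, isChain_parent_congr (b :: t) hc' ?_⟩
    intro x hx
    exact hd x (by rw [List.dropLast_cons_cons]; exact List.mem_cons_of_mem _ hx)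

/-- **The branch towards a smaller root set through a larger one**: if `R ⊆ R'` and the parent
maps of `F` (rooted at `R`) and `F'` (rooted at `R'`) agree off `R'`, then the branch of `F` from
`v ∉ R'` is the branch of `F'` from `v` followed, from its endpoint `r ∈ R'`, by the branch of
`F` from `r` (empty if `r ∈ R`). [folklore] -/
theorem br_eq_br_append (F : Forest H R) (F' : Forest H' R') (hRR' : R ⊆ R')
    (hag : ∀ a, a ∉ R' → F.parent a = F'.parent a) {v : V} (hv : v ∉ R') :
    F.br v = F'.br v ++
      (if (v :: F'.br v).getLast (List.cons_ne_nil _ _) ∈ R then []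
        else F.br ((v :: F'.br v).getLast (List.cons_ne_nil _ _))) := by
  set r := (v :: F'.br v).getLast (List.cons_ne_nil _ _) with hr
  have hvR : v ∉ R := fun h ↦ hv (hRR' h)
  have hst' := F'.isStoppedAt_br hv
  have hch' : List.IsChain (fun a b => F.parent a = b) (v :: F'.br v) :=
    isChain_parent_congr _ (F'.isChain_parent_br v) fun a ha ↦
      hag a fun h ↦ hst'.not_mem_of_mem_dropLast ha h
  have havoid : ∀ a ∈ (v :: F'.br v).dropLast, a ∉ R := fun a ha h ↦
    hst'.not_mem_of_mem_dropLast ha (hRR' h)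
  have hrR' : r ∈ R' := hst'.getLast_mem
  refine F.br_eq_of_isChain_of_isStoppedAt ?_ ?_ hvR
  · -- chain
    rw [← List.cons_append]
    split_ifs with hrR
    · rwa [List.append_nil]
    · refine List.IsChain.append hch' (F.isChain_parent_br r).tail fun x hx y hy ↦ ?_
      rw [List.getLast?_eq_getLast_of_ne_nil (List.cons_ne_nil _ _), Option.mem_def,
        Option.some_inj] at hx
      have hc := F.isChain_parent_br r
      have hne : F.br r ≠ [] := fun h ↦
        hrR (by simpa [h] using (F.isStoppedAt_br hrR).getLast_mem)
      rw [← List.cons_head_tail hne, List.isChain_cons_cons] at hc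
      rw [List.head?_eq_some_head hne, Option.mem_def, Option.some_inj] at hy
      rw [← hx, ← hy]
      exact hc.1
  · -- stopped at `R`
    rw [← List.cons_append]
    split_ifs with hrR
    · rw [List.append_nil]
      exact ⟨List.cons_ne_nil _ _, hrR, havoid⟩
    · have hne : F.br r ≠ [] := fun h ↦
        hrR (by simpa [h] using (F.isStoppedAt_br hrR).getLast_mem)
      refine isStoppedAt_append_left ?_ ((F.isStoppedAt_br hrR).tail hne)
      intro a ha
      have ha' : a ∈ (v :: F'.br v).dropLast ++ [r] := by rwa [hr, List.dropLast_concat_getLast]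
      rcases List.mem_append.1 ha' with h | h
      · exact havoid a h
      · rw [List.mem_singleton.1 h]
        exact hrR

omit [Fintype V] [DecidableEq V] in
/-- A parent-chain starting in a set `Q` closed under the parent map off `R` stays in `Q` as
long as it stays off `R` (and one step more). [folklore] -/
theorem forall_mem_of_isChain_parent {p : V → V} {Q R : Finset V}
    (hQ : ∀ a ∈ Q, a ∉ R → p a ∈ Q) :
    ∀ (l : List V), List.IsChain (fun a b => p a = b) l → (∀ a ∈ l.head?, a ∈ Q) →
      (∀ a ∈ l.dropLast, a ∉ R) → ∀ a ∈ l, a ∈ Q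
  | [], _, _, _ => by simp
  | [x], _, hh, _ => by simpa using hh
  | x :: y :: t, hc, hh, hd => by
    obtain ⟨hxy, hc'⟩ := List.isChain_cons_cons.1 hc
    have hx : x ∈ Q := hh x (by simp)
    have hy : y ∈ Q := hxy ▸ hQ x hx (hd x (by simp))
    intro a ha
    rcases List.mem_cons.1 ha with rfl | ha
    · exact hx
    · exact forall_mem_of_isChain_parent hQ (y :: t) hc' (by simpa using hy)
        (fun b hb ↦ hd b (by rw [List.dropLast_cons_cons]; exact List.mem_cons_of_mem _ hb)) a ha

end Forest

end Literature.Probability.LatticeModels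

namespace Literature.Probability.RandomPlanarGeometry

namespace USTPeano

open Literature.Probability.LatticeModels

namespace PeelData

variable {P₀ : Finset (ℤ × ℤ)} {S : PeelData}

/-- **The parent of an added root is a root**: along a prefix, the parent in `T(γ)` of a root of
the peeled data which is not a root of `S` (an endpoint `farP` of an edge added alongside a dual
step of the prefix) is again a root of the peeled data. [cite: LawlerSchrammWerner2004, Lemma 4.1] -/
theorem Good.parent_mem_roots_peelAlong : ∀ (w : List (ℤ × ℤ)) (S : PeelData) (h : S.Good)
    (hP : S.amb ⊆ P₀) (γ : {l // S.IsPath l}) (_ : w <+: γ.1.tail) (_ : S.b ∉ w) (v : ↥P₀),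
    v ∈ (S.peelAlong w).roots P₀ → v ∉ S.roots P₀ →
      (Good.pathForestEquiv S h hP γ).parent v ∈ (S.peelAlong w).roots P₀
  | [], _, _, _, _, _, _, v, hv, hv' => (hv' hv).elim
  | q :: w, S, h, hP, γ, hw, hb, v, hv, hv' => by
    obtain ⟨hV, hf⟩ := h.first_step_facts γ.2 hw hb
    obtain ⟨t, ht, hwt⟩ := List.cons_prefix_iff.1 hw
    have hne : γ.1.tail ≠ [] := γ.2.tail_ne_nil h
    have hb' : S.b ∉ w := fun h' ↦ hb (List.mem_cons_of_mem _ h')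
    have hwt' : w <+: γ.1.tail.tail := by rw [ht]; exact hwt
    have hsub := Good.roots_subset_roots_peelAlong (q :: w) S h γ.1 γ.2 hw hb P₀
    rcases hf with ⟨hqd, hE⟩ | ⟨hqp, hE'⟩
    · have hd : γ.1.tail.head hne = stepD S.a := by simp [ht, hqd]
      have hb₀ : stepD S.a ≠ S.b := h.stepD_ne_b hV hE
      rw [h.pathForestEquiv_parent_of_stepD hP hV γ hd v]
      split_ifs with hc
      · exact hsub (h.U₀_mem_roots hP)
      · rw [peelAlong_cons_of_eq _ _ hqd] at hv ⊢
        have hv₁ : v ∉ S.peelE.roots P₀ := fun hv₁ ↦ by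
          by_cases hn : farP S.a ∈ S.α
          · obtain ⟨t', ht'⟩ := hE.2.resolve_left fun h' ↦ h' hn
            rw [h.roots_peelE_of_eq hE hb₀ ht'] at hv₁
            exact hv' hv₁
          · rcases (h.mem_roots_peelE_of_notMem hE hb₀ hn).1 hv₁ with h1 | h1
            · exact hc ⟨Subtype.ext h1, hn⟩
            · exact hv' h1
        exact Good.parent_mem_roots_peelAlong w S.peelE (h.peelE hE hb₀)
          ((h.amb_peelE_subset hE hb₀).trans hP) ⟨γ.1.tail, γ.2.cons_tail.tail_peelE h hne hd⟩
          hwt' hb' v hv hv₁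
    · have hp : γ.1.tail.head hne = stepP S.a := by simp [ht, hqp]
      have hb'' : stepD S.swap.a ≠ S.swap.b := h.swap.stepD_ne_b (swap_V_ne_empty hV) hE'
      rw [h.pathForestEquiv_parent_of_stepP hP hV γ hp]
      rw [peelAlong_cons_of_ne _ _ fun e ↦ stepD_ne_stepP S.a (e.symm.trans hqp)] at hv ⊢
      have hv₁ : v ∉ S.peelP.roots P₀ := by rwa [h.roots_peelP hE' hb'']
      exact Good.parent_mem_roots_peelAlong w S.peelP (h.peelP_good hE' hb'')
        ((h.amb_peelP_subset hE' hb'').trans hP) ⟨γ.1.tail, γ.2.tail_peelP h hp⟩ hwt'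
        (by rwa [peelP_b]) v hv hv₁

/-- Along a prefix, the branch of `T(γ)` from a root of the peeled data stays among those roots
(its non-final vertices are the added roots, off `α`). [folklore] -/
theorem Good.forall_mem_br_of_mem_roots_peelAlong (h : S.Good) (hP : S.amb ⊆ P₀) {w : List (ℤ × ℤ)}
    (γ : {l // S.IsPath l}) (hw : w <+: γ.1.tail) (hb : S.b ∉ w) {r : ↥P₀}
    (hr : r ∈ (S.peelAlong w).roots P₀) (hrR : r ∉ S.roots P₀) :
    ∀ a ∈ (r :: (Good.pathForestEquiv S h hP γ).br r).dropLast,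
      a ∈ (S.peelAlong w).roots P₀ ∧ a ∉ S.roots P₀ := by
  set F := Good.pathForestEquiv S h hP γ
  have hst := F.isStoppedAt_br hrR
  have hall := Forest.forall_mem_of_isChain_parent (Q := (S.peelAlong w).roots P₀) (R := S.roots P₀)
    (fun a ha ha' ↦ Good.parent_mem_roots_peelAlong w S h hP γ hw hb a ha ha')
    (r :: F.br r) (F.isChain_parent_br r) (by simpa using hr) fun a ha ↦ hst.not_mem_of_mem_dropLast ha
  exact fun a ha ↦ ⟨hall a (List.dropLast_subset _ ha), hst.not_mem_of_mem_dropLast ha⟩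

/-- **The branch of `T(γ)` along a prefix** ([LSW04] Lemma 4.1 as used in the proof of Thm. 4.4,
p. 976, "by Lemma 4.1, `P[A | D_n]` is the same as `ĥ_n(v₀)`"): for a Peano path `γ` of `S`
with the prefix `a, q₁, …, q_n`, peeled data `S'` and remainder `γ[n, ℓ+1]`, the path in the
tree `T(γ)` from a vertex `v` off `α_n` (the roots of `S'`) to `α` is the path in the tree
`T'(γ[n, ℓ+1])` of the remainder from `v` to `α_n`, followed — from its endpoint `r ∈ α_n`,
when `r ∉ α` — by the path from `r` to `α` in the tree of any fixed path `γ₀` with the same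
prefix (a continuation determined by the prefix). [cite: LawlerSchrammWerner2004, Lemma 4.1] -/
theorem Good.br_pathForestEquiv_prefix (h : S.Good) (hP : S.amb ⊆ P₀) {w : List (ℤ × ℤ)}
    (γ₀ γ : {l // S.IsPath l}) (hw₀ : w <+: γ₀.1.tail) (hw : w <+: γ.1.tail) (hb : S.b ∉ w)
    (S' : PeelData) (hS' : S.peelAlong w = S') (h' : S'.Good) (hP' : S'.amb ⊆ P₀)
    (hγ' : S'.IsPath (γ.1.drop w.length)) {v : ↥P₀} (hv : v ∉ S'.roots P₀) :
    (Good.pathForestEquiv S h hP γ).br v =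
      (Good.pathForestEquiv S' h' hP' ⟨γ.1.drop w.length, hγ'⟩).br v ++
        (if (v :: (Good.pathForestEquiv S' h' hP' ⟨γ.1.drop w.length, hγ'⟩).br v).getLast
            (List.cons_ne_nil _ _) ∈ S.roots P₀ then []
          else (Good.pathForestEquiv S h hP γ₀).br
            ((v :: (Good.pathForestEquiv S' h' hP' ⟨γ.1.drop w.length, hγ'⟩).br v).getLast
              (List.cons_ne_nil _ _))) := by
  subst hS'
  set T := Good.pathForestEquiv S h hP γ
  set T₀ := Good.pathForestEquiv S h hP γ₀
  set T' := Good.pathForestEquiv (S.peelAlong w) h' hP' ⟨γ.1.drop w.length, hγ'⟩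
  have hRR' : S.roots P₀ ⊆ (S.peelAlong w).roots P₀ :=
    Good.roots_subset_roots_peelAlong w S h γ.1 γ.2 hw hb P₀
  have step := Forest.br_eq_br_append T T' hRR'
    (fun a ha ↦ Good.pathForestEquiv_parent_peelAlong w S h hP γ hw hb _ rfl h' hP' hγ' a ha) hv
  rw [step]
  set r := (v :: T'.br v).getLast (List.cons_ne_nil _ _)
  split_ifs with hrR
  · rfl
  · congr 1
    have hrR' : r ∈ (S.peelAlong w).roots P₀ := (T'.isStoppedAt_br hv).getLast_mem
    refine T.br_eq_of_isChain_of_isStoppedAt ?_ (T₀.isStoppedAt_br hrR) hrR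
    refine Forest.isChain_parent_congr _ (T₀.isChain_parent_br r) fun a ha ↦ ?_
    exact Good.pathForestEquiv_parent_eq_of_prefix w S h hP γ γ₀ hw hw₀ hb a
      (h.forall_mem_br_of_mem_roots_peelAlong hP γ₀ hw₀ hb hrR' hrR a ha).1

end PeelData

end USTPeano

end Literature.Probability.RandomPlanarGeometry
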